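/-
Copyright (c) 2026 the pub-hodgecm-mathlib formalisation cell (harness21).  Prover seat hodgecm-mathlib-F0P3-p01 (g32), Track A «(D-RAM) FOUR-FRAME», unit U2H, census leaf
(ρ2b′-X) — T5b «toric level census, type RamK»: the HALVED norm-depth index in division-free form (organ B4).  2026-09-04.
-/
import Literature.NumberTheory.LocalFields.QuadraticOrderNormDepthIndexRamK   -- ★ p857459 (this seat): the RamK frame, `[U_M : B_c]` closed form; brings ★ p857360 ∕ p857378 ∕ p857442 ∕ p857339
import HarnessLib

/-!
# The type-RamK norm-depth index above the threshold, division-free: `[U_M : B_c]·2 = (q+1)·q^{⌈c∕2⌉−1}` for `c ≥ 2d − 1`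
(Serre, *Local Fields* Ch. V §3 Cor. 3; Flicker 1998 p. 84)

Topic `NumberTheory/LocalFields`; namespace `Literature.NumberTheory.LocalFields.QuadraticOrder`.  THEOREMS ONLY (no definition, no instance, no notation, no named fact, no
`sorry`); kernel lane `--supports stmt-HodgeConjecture-24833` (count-neutral).  Cell `pub/hodgecm-mathlib` (D-0151), crux H413, Track A, unit U2H, census leaf (ρ2b′-X), type RamK.
★ `relIndex_normDepth_eq_of_ramK` (p857459) states the index `[U_M : B_c]` with a natural-number division `∕ 2` in the regime `c ≥ 2d − 1` (there `B_c = N⁻¹(Ṽ_c)` with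
`Ṽ_c ≤ N(U_M)` of index `2` in `Ũ`).  The explicit level tables of the T5b HEAD need the EXACT relation; THIS FILE records it: **`relIndex_normDepth_mul_two_eq_of_ramK`** —
for `2d ≤ c + 1`, `[U_M : B_c]·2 = [Ũ : Ṽ_c] = (q+1)·q^{⌈c∕2⌉−1}` (★ `relIndex_comap_mul_two_of_le`, ★ `relIndex_thetaFixed_depth_eq_of_unramified`, hFN discharged by ★
`exists_mul_map_eq_of_fixed_fixed_of_thirdField`).
HONEST LABEL: HC_CM is proved only modulo the 7 printed citations (2 remaining named inputs: hLiu418 = stmt-HodgeConjecture-24832, h413 = stmt-HodgeConjecture-24833) until rung 0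
closes; unconditional local algebra, count-neutral.

## References
* [Serre1979] J.-P. Serre, *Local Fields*, GTM 67 (1979): Ch. V §3 Cor. 3, §2 Prop. 3.
* [Flicker1998UnitaryFL] Y. Flicker, Prop. 7 p. 84.
-/

set_option autoImplicit false

open WithZero IsLocalRing
open scoped Valued
open Literature.NumberTheory.Automorphic.UnitaryThreeFourFrame
open Literature.NumberTheory.LocalFields.WildQuadraticDatum

namespace Literature.NumberTheory.LocalFields.QuadraticOrder

section RamKHalf

variable {K K' : Type} [Field K] [Valued K ℤᵐ⁰] [Field K'] [Valued K' ℤᵐ⁰] {ρ Θ : K →+* K} {α : K} {σ' : K' →+* K'} {α' π' : K'}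

/-- **THE HALVED RamK NORM-DEPTH INDEX, DIVISION-FREE**: for `2d ≤ c + 1`, `[U_M : B_c]·2 = (q+1)·q^{⌈c∕2⌉−1}` (two-field RamK frame of ★ `relIndex_normDepth_eq_of_ramK`).
[cite: Serre1979, Ch. V §3 Cor. 3] [cite: Flicker1998UnitaryFL, Prop. 7 p. 84] -/
theorem relIndex_normDepth_mul_two_eq_of_ramK [CompleteSpace K] [Finite 𝓀[K]] [CompleteSpace K'] [IsDiscreteValuationRing 𝒪[K']] [Finite 𝓀[K']]
    (hρρ : ∀ x, ρ (ρ x) = x) (hvρ : ∀ x, Valued.v (ρ x) = Valued.v x) (hα1 : Valued.v α ≤ 1) (hδ : Valued.v (α - ρ α) = 1)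
    (hΘρ : ∀ x, Θ (ρ x) = ρ (Θ x)) {ϖ : K} {d t : ℕ} (hD : IsRamifiedQuadraticDatum Θ ϖ d t) (hρϖ : ρ ϖ = ϖ)
    (hσ' : ∀ x, σ' (σ' x) = x) (hvσ' : ∀ x, Valued.v (σ' x) = Valued.v x) (hα'1 : Valued.v α' ≤ 1) (hα' : Valued.v (α' - σ' α') = 1)
    (hπ' : Valued.v π' = exp (-1 : ℤ)) {q : ℕ} (hq : Nat.card 𝓀[K'] = q ^ 2)
    (jK : K' →+* K) (hjv : ∀ x, Valued.v (jK x) = Valued.v x ^ 2) (hjΘ : ∀ x, Θ (jK x) = jK x) (hjfix : ∀ z : K, Θ z = z → ∃ x, jK x = z)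
    (hjσ : ∀ x, jK (σ' x) = ρ (jK x))
    {c : ℕ} (hc : 2 * d ≤ c + 1) (U Ut Vt B : Subgroup Kˣ) (hU : ∀ u, u ∈ U ↔ Valued.v (u : K) = 1)
    (hUt : ∀ z, z ∈ Ut ↔ Θ (z : K) = z ∧ Valued.v (z : K) = 1)
    (hVt : ∀ z, z ∈ Vt ↔ Θ (z : K) = z ∧ Valued.v (z : K) = 1 ∧ Valued.v ((z : K) - ρ z) ≤ exp (-(c : ℤ)))
    (hB : ∀ ω, ω ∈ B ↔ Valued.v (ω : K) = 1 ∧ Valued.v ((ω : K) * Θ ω - ρ ((ω : K) * Θ ω)) ≤ exp (-(c : ℤ))) :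
    B.relIndex U * 2 = (q + 1) * q ^ ((c + 1) / 2 - 1) := by
  have hFN : ∀ f : K, ρ f = f → Θ f = f → Valued.v f = 1 → ∃ x : K, x * Θ x = f := fun f hρf hΘf hf =>
    exists_mul_map_eq_of_fixed_fixed_of_thirdField hρρ hvρ hΘρ hD hσ' hvσ' hα'1 hα' hπ' jK hjv hjΘ hjfix hjσ hρf hΘf hf
  have hΘΘ := hD.1; have hvΘ := hD.2.1
  have hd : 1 ≤ d := hD.2.2.2.2.2.1
  have hc1 : 1 ≤ c := by omega
  set N : Kˣ →* Kˣ := MonoidHom.id Kˣ * Units.map (Θ : K →* K) with hN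
  have hNval : ∀ ω : Kˣ, ((N ω : Kˣ) : K) = (ω : K) * Θ ω := fun ω => coe_normHom ω
  have hNΘ : ∀ ω : Kˣ, Θ (((N ω : Kˣ) : K)) = ((N ω : Kˣ) : K) := fun ω => by rw [hNval, map_mul, hΘΘ, mul_comm]
  have hN1 : ∀ {ω : Kˣ}, Valued.v (ω : K) = 1 → Valued.v (((N ω : Kˣ) : K)) = 1 := fun hω => by rw [hNval, map_mul, hvΘ, hω, mul_one]
  -- `B = N⁻¹ Ṽ ⊓ U`, `N(U) ≤ Ũ` of index 2, and above the threshold `Ṽ ≤ N(U)`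
  have hBeq : B = (Vt.comap N) ⊓ U := by
    ext ω
    rw [hB, Subgroup.mem_inf, Subgroup.mem_comap, hVt, hU]
    constructor
    · rintro ⟨h1, h2⟩
      exact ⟨⟨hNΘ ω, hN1 h1, by rw [hNval]; exact h2⟩, h1⟩
    · rintro ⟨⟨-, -, h2⟩, h1⟩
      rw [hNval] at h2
      exact ⟨h1, h2⟩
  have hle : U.map N ≤ Ut := by
    rintro _ ⟨ω, hω, rfl⟩
    exact (hUt _).2 ⟨hNΘ ω, hN1 ((hU ω).1 hω)⟩
  have h2 : (U.map N).relIndex Ut = 2 := map_normHom_units_relIndex_eq_two hD hU hUt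
  have hV : Vt ≤ U.map N := by
    intro z hz
    obtain ⟨hΘz, hz1, hzc⟩ := (hVt z).1 hz
    exact (mem_map_normHom_iff hvΘ hU hz1).2 (exists_mul_map_eq_of_depth_of_le hρρ hvρ hα1 hδ hΘρ hD hρϖ hFN hc hΘz hz1 hzc)
  rw [hBeq, Subgroup.inf_relIndex_right, relIndex_comap_mul_two_of_le N hle h2 hV]
  exact relIndex_thetaFixed_depth_eq_of_unramified hσ' hvσ' hα'1 hα' hπ' hq jK hjv hjΘ hjfix hjσ hc1 Ut Vt hUt hVt

end RamKHalf

end Literature.NumberTheory.LocalFields.QuadraticOrder
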